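import Literature.AnabelianGeometry.SemiGraphs.ArithTotalEstrangementSplitObstruction
import Literature.AnabelianGeometry.SemiGraphs.WitnessIwahoriBundle
import HarnessLib

/-!
# [SemiAnbd] Def 5.3 (ii) / Thm 5.4: the split-model obstruction to total arithmetic estrangement AT THE
# TREE'S Thm-3.7 WITNESS WITH AN EDGE (`IwahoriWitness.loopGraph`), and the second-clause form

Mochizuki, *Semi-graphs of anabelioids*, Publ. RIMS **42** (2006) 221–322, §5 Def 5.3 (ii) p. 65, Thm 5.4
p. 66. [cite: MochizukiSemiAnbd2006, Def 5.3 (ii), p. 65]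

PROOF-ONLY corollary file (abc-iut cell, L3 sub-DAG `plan/L3/SUBDAG-SemiAnbd-Thm54.md`, NV row «NV-L3
hest-needs-nontrivial-ρ», seat abc-iut-w4-d040 gen 4).  No definition, no new named fact.  abc-iut-w6-d072's
`ArithTotalEstrangementSplitObstruction.lean` (p433406) proves that at the TRIVIAL outer action `ρ = 1` the
design input `hest : IsTotallyArithEstranged D aug` of the T54-B capstones FAILS at every vertex carrying two
distinct branches.  abc-iut-w6-d099's non-vacuity certificate (`ArithThm54DesignInputsNonVacuity.lean`)
recorded the residual «a contentful witness of `hest` needs a Thm-3.7 graph WITH an edge; every Thm-3.7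
witness in the tree is edgeless».  The tree DOES hold a Thm-3.7 witness with an (estranged) edge —
abc-iut-w5-d236's `IwahoriWitness.loopGraph p` with `loopGraph_thm37Hypotheses` (WitnessIwahoriBundle.lean) —
and this file records, by name, that the split-model obstruction bites exactly there:

* `not_isTotallyArithEstranged_of_trivial'` — abc-iut-w6-d072's obstruction restated WITHOUT its (unused)
  instance binder `[TopologicalSpace (π₁^temp(𝒢) ⋊^out Π_A)]` (total arithmetic estrangement mentions only the
  topology of `Π_A`), so that consumers need no topology on the outer model;
* `not_isArithEstrangedEdge_of_lt_of_trivial` — Def 5.3 (ii)'s SECOND clause also fails at `ρ = 1`: an edge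
  with a branch `b → v` whose arithmetic branch group is a proper subgroup of the vertex group is not
  arithmetically estranged (at any `g ∈ Π^temp_{𝔊,v} ∖ Π^temp_{𝔊,b}`), by abc-iut-w6-d072's
  `isArithAmple_brGp_inf_conjSubgroup_of_trivial`;
* `IwahoriWitness.not_isTotallyArithEstranged_loopGraph_of_trivial` — at `loopGraph p` (one vertex, one
  geometrically estranged loop, Thm 3.7's hypotheses inhabited), for EVERY chart, every `Π_A`, every choice of
  representatives, `hest` fails at `ρ = 1`: the loop's two branches abut to the unique vertex.

Reading (no side taken): geometric estrangement (Def 2.4 (iv)) of the edge does not rescue arithmetic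
estrangement at a split outer action; a contentful non-vacuity witness of Thm 5.4's `hest` needs `ρ ≠ 1`
(Ex 5.6: the arithmetic twist at a node).  Nothing here bears on [IUTchIII] Cor. 3.12; typed ≠ proved.
-/

namespace Literature.AnabelianGeometry.SemiGraphs

universe u w

namespace ProfiniteSemiGraph

open Literature.AnabelianGeometry.EtaleTheta

variable {𝒢 : ProfiniteSemiGraph.{u}} (c : TemperedPiChart 𝒢) {PA : Type w} [Group PA] [TopologicalSpace PA]

/-- **abc-iut-w6-d072's split-model obstruction, instance-free form**: at the trivial outer action the
produced decomposition data are NOT totally arithmetically estranged as soon as some vertex carries two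
distinct branches — stated without a topology on `π₁^temp(𝒢) ⋊^out Π_A` (none is needed; any one may be
chosen inside the proof). [cite: MochizukiSemiAnbd2006, Def 5.3 (ii), p. 65] -/
theorem not_isTotallyArithEstranged_of_trivial' (Rc : ChartRepresentatives c)
    {b b' : 𝒢.graph.Branch} {v : 𝒢.graph.Vertex} (hb : 𝒢.graph.abuts b = some v)
    (hb' : 𝒢.graph.abuts b' = some v) (hne : b' ≠ b) :
    ¬ IsTotallyArithEstranged
        (decompositionDataOfChart Rc (toOuterSemidirectProduct (1 : PA →* TopOut c.G)))
        (outerSemidirectProductSnd (1 : PA →* TopOut c.G)) := by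
  letI : TopologicalSpace (outerSemidirectProduct (1 : PA →* TopOut c.G)) := ⊥
  exact not_isTotallyArithEstranged_of_trivial c Rc hb hb' hne

/-- **Def 5.3 (ii), SECOND clause, fails at the trivial outer action**: an edge with a branch `b → v` and
some `g ∈ Π^temp_{𝔊,v} ∖ Π^temp_{𝔊,b}` (i.e. the arithmetic branch group is a proper subgroup of the vertex
group) is NOT arithmetically estranged at `ρ = 1`, since `Π^temp_{𝔊,b} ∩ g Π^temp_{𝔊,b} g⁻¹ ∋ (1, a)` for
all `a` (abc-iut-w6-d072's `isArithAmple_brGp_inf_conjSubgroup_of_trivial`).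
[cite: MochizukiSemiAnbd2006, Def 5.3 (ii), p. 65] -/
theorem not_isArithEstrangedEdge_of_lt_of_trivial (Rc : ChartRepresentatives c)
    {v : 𝒢.graph.Vertex} {b : 𝒢.graph.Branch} (hb : 𝒢.graph.abuts b = some v)
    {g : outerSemidirectProduct (1 : PA →* TopOut c.G)}
    (hgv : g ∈ arithVertGp Rc (toOuterSemidirectProduct (1 : PA →* TopOut c.G)) v)
    (hgb : g ∉ arithBrGp Rc (toOuterSemidirectProduct (1 : PA →* TopOut c.G)) b) :
    ¬ IsArithEstrangedEdge (decompositionDataOfChart Rc (toOuterSemidirectProduct (1 : PA →* TopOut c.G)))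
      (outerSemidirectProductSnd (1 : PA →* TopOut c.G)) (𝒢.graph.edgeOf b) := by
  letI : TopologicalSpace (outerSemidirectProduct (1 : PA →* TopOut c.G)) := ⊥
  intro h
  exact (h b rfl v hb g hgv).2 hgb (isArithAmple_brGp_inf_conjSubgroup_of_trivial c Rc b b g)

/-- Hence `hest` also fails at `ρ = 1` whenever some arithmetic branch group is a proper subgroup of its
vertex group (vertices of valence one included). [cite: MochizukiSemiAnbd2006, Thm 5.4, p. 66] -/
theorem not_isTotallyArithEstranged_of_lt_of_trivial (Rc : ChartRepresentatives c)
    {v : 𝒢.graph.Vertex} {b : 𝒢.graph.Branch} (hb : 𝒢.graph.abuts b = some v)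
    {g : outerSemidirectProduct (1 : PA →* TopOut c.G)}
    (hgv : g ∈ arithVertGp Rc (toOuterSemidirectProduct (1 : PA →* TopOut c.G)) v)
    (hgb : g ∉ arithBrGp Rc (toOuterSemidirectProduct (1 : PA →* TopOut c.G)) b) :
    ¬ IsTotallyArithEstranged
        (decompositionDataOfChart Rc (toOuterSemidirectProduct (1 : PA →* TopOut c.G)))
        (outerSemidirectProductSnd (1 : PA →* TopOut c.G)) :=
  fun h => not_isArithEstrangedEdge_of_lt_of_trivial c Rc hb hgv hgb (h (𝒢.graph.edgeOf b))

end ProfiniteSemiGraph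

/-! ### At the Thm-3.7 witness with an estranged loop -/

namespace IwahoriWitness

open ProfiniteSemiGraph Literature.AnabelianGeometry.EtaleTheta

variable (p : ℕ) [Fact p.Prime] {PA : Type w} [Group PA] [TopologicalSpace PA]

/-- **At `IwahoriWitness.loopGraph p`** — one vertex with an Iwahori-type group, one geometrically ESTRANGED
loop, Thm 3.7's hypotheses inhabited (`loopGraph_thm37Hypotheses`, abc-iut-w5-d236) — **total arithmetic
estrangement FAILS at the trivial outer action**, for every chart of `π₁^temp(𝒢₁)`, every `Π_A` and every choice
of representatives: the loop's two branches abut to the unique vertex, so abc-iut-w6-d072's split-model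
obstruction applies.  A contentful witness of Thm 5.4's `hest` at this graph needs `ρ ≠ 1`.
[cite: MochizukiSemiAnbd2006, Thm 5.4, p. 66] -/
theorem not_isTotallyArithEstranged_loopGraph_of_trivial (c : TemperedPiChart (loopGraph p))
    (Rc : ChartRepresentatives c) :
    ¬ IsTotallyArithEstranged (decompositionDataOfChart Rc (toOuterSemidirectProduct (1 : PA →* TopOut c.G)))
      (outerSemidirectProductSnd (1 : PA →* TopOut c.G)) := by
  obtain ⟨b₁, b₂, hne, -, -, -⟩ := (loopGraph p).graph.two_branches (ULift.up (0 : Fin 1))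
  -- every branch of the bouquet abuts to its unique vertex
  haveI : Subsingleton (loopGraph p).graph.Vertex := show Subsingleton PUnit from inferInstance
  obtain ⟨w₁, hw₁⟩ := Option.isSome_iff_exists.mp ((loopGraph_isGraph p).abuts_isSome b₁)
  obtain ⟨w₂, hw₂⟩ := Option.isSome_iff_exists.mp ((loopGraph_isGraph p).abuts_isSome b₂)
  rw [Subsingleton.elim w₂ w₁] at hw₂
  exact not_isTotallyArithEstranged_of_trivial' c Rc hw₁ hw₂ hne.symm

end IwahoriWitness

end Literature.AnabelianGeometry.SemiGraphs
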